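import Mathlib
import Summits.Ventures.PercRepro2.SkeletonReduces
import Summits.Ventures.PercRepro2.HubTheorem3
import Summits.Ventures.PercRepro2.StarHClass
import Summits.Ventures.PercRepro2.StarHLeafMulti

/-!
# The (HMF) / (HCOV) class table modulo reduction (blind cell PercRepro2, night-1 g16;
NIGHT1-G16.md §3)

With the reduction relation `Skeleton.Reduces` and its invariance theorems (SkeletonReduces.lean),
every class theorem of the S-table extends to all instances that REDUCE to it.  The three hub classes
of the third mark, stated on the NONZERO edges of the reduct (zero-weight edges may sit anywhere —
one more re-routing move puts them on loops at `a₁`):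

* **`HCov_of_reduces_marks_at_a3`** — the reduct has every nonzero edge at `a₃` joining `a₃` to a
  mark (class R₃, `Hub3.HCov_of_classR3`): (HCOV) on the original instance;
* **`HMF_of_reduces_star_h`** — the reduct carries the four-coin star at `a₃` (one edge to each of
  `a₁, a₂, o, b`, any weights including `0`, no other nonzero edge at `a₃`; `StarH.HMF_star_h`):
  (HMF), hence (HCOV);
* **`HMF_of_reduces_leaf_hub`** — in the reduct `a₃` is a nonzero leaf at an unmarked `u` whose
  other nonzero edges go to marks or to unmarked whiskers (`StarH.HMF_leaf_marks_whiskers`): (HMF),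
  hence (HCOV).

Own code; standard axioms.
-/

open scoped Classical

namespace Summit.Ventures.PercRepro2

open UnionCluster CovForm

namespace Skeleton

section Classes

variable {V : Type*} {E : Type*} [Fintype E] [DecidableEq E] [Fintype V] [DecidableEq V]
  {R : Type*} [Field R] [LinearOrder R] [IsStrictOrderedRing R]

variable {o a₁ a₂ a₃ b : V}

omit [Fintype E] [Fintype V] [DecidableEq V] [IsStrictOrderedRing R] in
/-- The re-routing of the zero-weight edges to loops at `a₁` is one move. -/
theorem step_reroute (q : E → R) (ends' : E → Sym2 V) :
    Step o a₁ a₂ a₃ b (q, ends') (q, reroute q ends' a₁) :=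
  Step.reroute fun _ he => (reroute_of_ne q ends' a₁ he).symm

omit [DecidableEq V] in
/-- **Class R₃ modulo reduction**: if the instance reduces to one in which every nonzero edge at `a₃`
joins `a₃` to a mark, (HCOV) holds. -/
theorem HCov_of_reduces_marks_at_a3 {p : E → R} {ends : E → Sym2 V} (hp : IsProbVec p)
    {q : E → R} {ends' : E → Sym2 V} (h : Reduces o a₁ a₂ a₃ b (p, ends) (q, ends'))
    (hinj : Function.Injective (Hub3.markOf3 o a₁ a₂ a₃ b))
    (hR : ∀ e, q e ≠ 0 → a₃ ∈ ends' e → ∃ m, ends' e = s(a₃, Hub3.markOf3 o a₁ a₂ a₃ b m)) :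
    HCov p ends o a₁ a₂ a₃ b := by
  have h31 : a₃ ≠ a₁ := hinj.ne (by decide : Hub.Mark.a₃ ≠ Hub.Mark.a₁)
  have h' : Reduces o a₁ a₂ a₃ b (p, ends) (q, reroute q ends' a₁) :=
    Relation.ReflTransGen.tail h (step_reroute q ends')
  refine HCov_of_reduces (I := (p, ends)) h' hp ?_
  refine Hub3.HCov_of_classR3 q (isProbVec_of_reduces (I := (p, ends)) h hp) _ o a₁ a₂ a₃ b hinj ?_
  intro e he
  obtain ⟨x, hx, y, hxy⟩ := he
  dsimp only at hxy ⊢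
  have hx3 : x = a₃ := Set.mem_singleton_iff.1 hx
  subst hx3
  have h3e : x ∈ reroute q ends' a₁ e := by rw [hxy]; exact Sym2.mem_mk_left x y
  have hqe : q e ≠ 0 := ne_zero_of_mem_reroute q ends' h31 h3e
  rw [reroute_of_ne q ends' a₁ hqe] at hxy ⊢
  obtain ⟨m, hm⟩ := hR e hqe (by rw [hxy]; exact Sym2.mem_mk_left x y)
  exact ⟨Hub.Mark.a₃, m, hm⟩

/-- The re-routing of the zero-weight edges OTHER than four designated edges to loops at `a₁`. -/
noncomputable def rerouteStar (q : E → R) (ends' : E → Sym2 V) (a₁ a₃ o a₂ b : V)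
    (f₁ f₂ f₃ f₄ : E) : E → Sym2 V :=
  fun e => if e = f₁ then s(a₃, a₁) else if e = f₂ then s(a₃, a₂) else if e = f₃ then s(a₃, o)
    else if e = f₄ then s(a₃, b) else if q e = 0 then s(a₁, a₁) else ends' e

/-- **The four-coin star at `a₃` modulo reduction**: if the instance reduces to one in which `a₃`
carries four designated edges `f₁, f₂, f₃, f₄` to `a₁, a₂, o, b` (each either of weight `0` or
placed at its mark) and no other nonzero edge, (HMF) — hence (HCOV) — holds. -/
theorem HMF_of_reduces_star_h {p : E → R} {ends : E → Sym2 V} (hp : IsProbVec p)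
    {q : E → R} {ends' : E → Sym2 V} (h : Reduces o a₁ a₂ a₃ b (p, ends) (q, ends'))
    {f₁ f₂ f₃ f₄ : E} (h12 : f₁ ≠ f₂) (h13 : f₁ ≠ f₃) (h14 : f₁ ≠ f₄) (h23 : f₂ ≠ f₃)
    (h24 : f₂ ≠ f₄) (h34 : f₃ ≠ f₄)
    (hf₁ : q f₁ ≠ 0 → ends' f₁ = s(a₃, a₁)) (hf₂ : q f₂ ≠ 0 → ends' f₂ = s(a₃, a₂))
    (hf₃ : q f₃ ≠ 0 → ends' f₃ = s(a₃, o)) (hf₄ : q f₄ ≠ 0 → ends' f₄ = s(a₃, b))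
    (hdeg : ∀ e, q e ≠ 0 → a₃ ∈ ends' e → e = f₁ ∨ e = f₂ ∨ e = f₃ ∨ e = f₄)
    (h31 : a₃ ≠ a₁) (h32 : a₃ ≠ a₂) (h3o : a₃ ≠ o) (h3b : a₃ ≠ b) :
    HMF p ends o a₁ a₂ a₃ b := by
  set ends'' := rerouteStar q ends' a₁ a₃ o a₂ b f₁ f₂ f₃ f₄ with hends''
  have hagree : ∀ e, q e ≠ 0 → ends' e = ends'' e := by
    intro e he
    simp only [hends'', rerouteStar]
    by_cases e1 : e = f₁
    · subst e1; simp [hf₁ he]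
    by_cases e2 : e = f₂
    · subst e2; simp [e1, hf₂ he]
    by_cases e3 : e = f₃
    · subst e3; simp [e1, e2, hf₃ he]
    by_cases e4 : e = f₄
    · subst e4; simp [e1, e2, e3, hf₄ he]
    simp [e1, e2, e3, e4, he]
  have h' : Reduces o a₁ a₂ a₃ b (p, ends) (q, ends'') :=
    Relation.ReflTransGen.tail h (Step.reroute hagree)
  refine HMF_of_reduces (I := (p, ends)) h' hp ?_
  have e1 : ends'' f₁ = s(a₃, a₁) := by simp [hends'', rerouteStar]
  have e2 : ends'' f₂ = s(a₃, a₂) := by simp [hends'', rerouteStar, h12.symm]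
  have e3 : ends'' f₃ = s(a₃, o) := by simp [hends'', rerouteStar, h13.symm, h23.symm]
  have e4 : ends'' f₄ = s(a₃, b) := by simp [hends'', rerouteStar, h14.symm, h24.symm, h34.symm]
  refine StarH.HMF_star_h q ends'' (isProbVec_of_reduces (I := (p, ends)) h hp) e1 e2 e3 e4 ?_
    h31 h32 h3o h3b h12 h13 h14 h23 h24 h34
  intro e he
  by_cases k1 : e = f₁
  · exact Or.inl k1
  by_cases k2 : e = f₂
  · exact Or.inr (Or.inl k2)
  by_cases k3 : e = f₃
  · exact Or.inr (Or.inr (Or.inl k3))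
  by_cases k4 : e = f₄
  · exact Or.inr (Or.inr (Or.inr k4))
  exfalso
  by_cases hq : q e = 0
  · have : ends'' e = s(a₁, a₁) := by simp [hends'', rerouteStar, k1, k2, k3, k4, hq]
    rw [this] at he
    exact h31 (by simpa using he)
  · have : ends'' e = ends' e := by simp [hends'', rerouteStar, k1, k2, k3, k4, hq]
    rw [this] at he
    rcases hdeg e hq he with k | k | k | k
    · exact k1 k
    · exact k2 k
    · exact k3 k
    · exact k4 k

/-- **The leaf-at-a-hub classes modulo reduction**: if the instance reduces to one in which `a₃` is a
nonzero leaf by `f = {a₃, u}` at an unmarked `u` whose other nonzero edges go to `a₃`, to marks, or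
to unmarked whiskers (vertices with that single nonzero edge), (HMF) — hence (HCOV) — holds. -/
theorem HMF_of_reduces_leaf_hub {p : E → R} {ends : E → Sym2 V} (hp : IsProbVec p)
    {q : E → R} {ends' : E → Sym2 V} (h : Reduces o a₁ a₂ a₃ b (p, ends) (q, ends'))
    {f : E} {u : V} (hf : ends' f = s(a₃, u)) (hqf : q f ≠ 0)
    (hleaf : ∀ e, q e ≠ 0 → a₃ ∈ ends' e → e = f)
    (hu : ∀ e, q e ≠ 0 → u ∈ ends' e →
      ends' e = s(u, a₃) ∨ ends' e = s(u, a₁) ∨ ends' e = s(u, a₂) ∨ ends' e = s(u, o) ∨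
        ends' e = s(u, b) ∨
        ∃ y, ends' e = s(u, y) ∧ y ≠ u ∧ y ≠ o ∧ y ≠ a₁ ∧ y ≠ a₂ ∧ y ≠ a₃ ∧ y ≠ b ∧
          ∀ e', q e' ≠ 0 → y ∈ ends' e' → e' = e)
    (h3u : a₃ ≠ u) (h3o : a₃ ≠ o) (h31 : a₃ ≠ a₁) (h32 : a₃ ≠ a₂) (h3b : a₃ ≠ b)
    (hu1 : u ≠ a₁) (hu2 : u ≠ a₂) (huo : u ≠ o) (hub : u ≠ b) :
    HMF p ends o a₁ a₂ a₃ b := by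
  set ends'' := reroute q ends' a₁ with hends''
  have h' : Reduces o a₁ a₂ a₃ b (p, ends) (q, ends'') :=
    Relation.ReflTransGen.tail h (step_reroute q ends')
  refine HMF_of_reduces (I := (p, ends)) h' hp ?_
  have hf'' : ends'' f = s(a₃, u) := by rw [hends'', reroute_of_ne q ends' a₁ hqf, hf]
  refine StarH.HMF_leaf_marks_whiskers ends'' o a₁ a₂ a₃ b u q
    (isProbVec_of_reduces (I := (p, ends)) h hp) hf'' ?_ ?_ h3u h3o h31 h32 h3b hu1 hu2 huo hub
  · intro e he
    have hqe : q e ≠ 0 := ne_zero_of_mem_reroute q ends' h31 he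
    rw [hends'', reroute_of_ne q ends' a₁ hqe] at he
    exact hleaf e hqe he
  · intro e he
    have hqe : q e ≠ 0 := ne_zero_of_mem_reroute q ends' hu1 he
    have hee : ends'' e = ends' e := by rw [hends'', reroute_of_ne q ends' a₁ hqe]
    rw [hee] at he ⊢
    rcases hu e hqe he with k | k | k | k | k | ⟨y, hy, hyu, hyo, hy1, hy2, hy3, hyb, hwh⟩
    · exact Or.inl k
    · exact Or.inr (Or.inl k)
    · exact Or.inr (Or.inr (Or.inl k))
    · exact Or.inr (Or.inr (Or.inr (Or.inl k)))
    · exact Or.inr (Or.inr (Or.inr (Or.inr (Or.inl k))))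
    · refine Or.inr (Or.inr (Or.inr (Or.inr (Or.inr ⟨y, hy, hyu, hyo, hy1, hy2, hy3, hyb, ?_⟩))))
      intro e' he'
      have hqe' : q e' ≠ 0 := ne_zero_of_mem_reroute q ends' hy1 he'
      rw [hends'', reroute_of_ne q ends' a₁ hqe'] at he'
      exact hwh e' hqe' he'

/-- (HCOV) for the leaf-at-a-hub classes modulo reduction. -/
theorem HCov_of_reduces_leaf_hub {p : E → R} {ends : E → Sym2 V} (hp : IsProbVec p)
    {q : E → R} {ends' : E → Sym2 V} (h : Reduces o a₁ a₂ a₃ b (p, ends) (q, ends'))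
    {f : E} {u : V} (hf : ends' f = s(a₃, u)) (hqf : q f ≠ 0)
    (hleaf : ∀ e, q e ≠ 0 → a₃ ∈ ends' e → e = f)
    (hu : ∀ e, q e ≠ 0 → u ∈ ends' e →
      ends' e = s(u, a₃) ∨ ends' e = s(u, a₁) ∨ ends' e = s(u, a₂) ∨ ends' e = s(u, o) ∨
        ends' e = s(u, b) ∨
        ∃ y, ends' e = s(u, y) ∧ y ≠ u ∧ y ≠ o ∧ y ≠ a₁ ∧ y ≠ a₂ ∧ y ≠ a₃ ∧ y ≠ b ∧
          ∀ e', q e' ≠ 0 → y ∈ ends' e' → e' = e)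
    (h3u : a₃ ≠ u) (h3o : a₃ ≠ o) (h31 : a₃ ≠ a₁) (h32 : a₃ ≠ a₂) (h3b : a₃ ≠ b)
    (hu1 : u ≠ a₁) (hu2 : u ≠ a₂) (huo : u ≠ o) (hub : u ≠ b) :
    HCov p ends o a₁ a₂ a₃ b :=
  HCov_of_HMF p hp ends o a₁ a₂ a₃ b
    (HMF_of_reduces_leaf_hub hp h hf hqf hleaf hu h3u h3o h31 h32 h3b hu1 hu2 huo hub)

/-- (HCOV) for the four-coin star modulo reduction. -/
theorem HCov_of_reduces_star_h {p : E → R} {ends : E → Sym2 V} (hp : IsProbVec p)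
    {q : E → R} {ends' : E → Sym2 V} (h : Reduces o a₁ a₂ a₃ b (p, ends) (q, ends'))
    {f₁ f₂ f₃ f₄ : E} (h12 : f₁ ≠ f₂) (h13 : f₁ ≠ f₃) (h14 : f₁ ≠ f₄) (h23 : f₂ ≠ f₃)
    (h24 : f₂ ≠ f₄) (h34 : f₃ ≠ f₄)
    (hf₁ : q f₁ ≠ 0 → ends' f₁ = s(a₃, a₁)) (hf₂ : q f₂ ≠ 0 → ends' f₂ = s(a₃, a₂))
    (hf₃ : q f₃ ≠ 0 → ends' f₃ = s(a₃, o)) (hf₄ : q f₄ ≠ 0 → ends' f₄ = s(a₃, b))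
    (hdeg : ∀ e, q e ≠ 0 → a₃ ∈ ends' e → e = f₁ ∨ e = f₂ ∨ e = f₃ ∨ e = f₄)
    (h31 : a₃ ≠ a₁) (h32 : a₃ ≠ a₂) (h3o : a₃ ≠ o) (h3b : a₃ ≠ b) :
    HCov p ends o a₁ a₂ a₃ b :=
  HCov_of_HMF p hp ends o a₁ a₂ a₃ b
    (HMF_of_reduces_star_h hp h h12 h13 h14 h23 h24 h34 hf₁ hf₂ hf₃ hf₄ hdeg h31 h32 h3o h3b)

end Classes

end Skeleton

end Summit.Ventures.PercRepro2
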